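import Literature.AnabelianGeometry.EtaleTheta.MuTwoSettingCLevel
import Literature.AnabelianGeometry.EtaleTheta.ThetaCohomologyInversion
import Literature.AnabelianGeometry.EtaleTheta.Discharge.Sec1InversionTemperedCriterion
import HarnessLib

/-!
# [EtTh] Def. 1.7 / Rmk. 2.1.1 / Prop. 2.2 (i): «`ε_±` (multiplication by `−1`) acts by `−1` on `(Δ^tp_X)^ell`» —
# the C4 clause of the 13:00Z v-next census as an ADDITIVE predicate over `MuTwoSetting` (class (c))

Mochizuki, *The étale theta function and its Frobenioid-theoretic manifestations*, Publ. RIMS **45** (2009): Def. 1.7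
p. 27 (printed 253) «`X^log → C^log` … the stack-theoretic quotient of `X^log` by the natural action of `±1`», «`ε_± ∈
Gal(Ẍ/C)`»; §2 Rmk. 2.1.1 p. 36 «`ι` acts on `Q` by multiplication by `−1`»; Prop. 2.2 (i) p. 37 «eigenvalues `−1` and
`1` [on `Δ̄^ell_X`, `Δ̄_Θ`]» [cite: MochizukiEtTh2009, Def 1.7 p.27]. abc-iut cell, layer L2, seat abc-iut-L2-t1 (owner of
`MuTwoSetting`, `ConstantMultipleRigidity.lean`). 13:00Z v-next census item C4 (GAP G-L2t10-4 (a) `hιell`): drafter's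
CALL (rule §0a) = «PREDICATE by default (`MuTwoSetting.InvActsByNegOnEll`, text = p432126's `hinv` shape of (R1e′)); ★
only if t1 shows every `MuTwoSetting` constructor site survives» — as the owner I take the PREDICATE route (the sites
`MuTwoSetting.model`, `inversionModel`, `model₂`-based and χ-based records are not re-certified here). CLASS (c):
additive `Prop`-valued predicates over the FROZEN `MuTwoSetting` and abc-iut-L2-d3's parameter record
`MuTwoSetting.CLevelData`; nothing asserted.

* `MuTwoSetting.InvActsByNegOnEllAt M g` — ALGEBRAIC, datum-free form: the inner automorphism of `Π^tp_C` by `g`,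
  restricted to `Π^tp_X` (`CLevelData.conjFun g`, a bare function), acts by `−1` on `(Δ^tp_X)^ell`:
  `((g x g⁻¹)^ell = (x^ell)⁻¹` for `x ∈ Δ^tp_X`;
* `MuTwoSetting.CLevelData.InvActsByNegOnEll e` — the census text: for EVERY geometric (`augC g = 1`) element `g`
  of `Π^tp_C ∖ Π^tp_X`, (R1e′) «`ĝ` acts as `−1` on `Δ_X^ab`» for `ĝ := completionAut (e.conjX g)` (abc-iut-L2-t10's
  binder `hinv` of `piCData_inv_ell_of_hinv`, p432126);
* PROVED: `invActsByNegOnEllAt_iff_hinv` — the two forms agree for each `g` (abc-iut-w5-d072's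
  `completionAut_mul_self_mem_iff` + the root field `ker_toEll`); `InvActsByNegOnEllAt.of_isInversionAut` — an
  `IsInversionAut (e.conjX g)` (`ThetaCohomologyInversion.lean`, clause `ell_apply`) gives it; `CLevelData.
  invActsByNegOnEll_iff` — the census predicate ⟺ the algebraic form at every geometric `g ∉ Π^tp_X`.
HONEST FRAMING: [EtTh] is refereed; nothing here bears on [IUTchIII] Cor. 3.12; typed ≠ proved; no side taken.
-/

noncomputable section

namespace Literature.AnabelianGeometry.EtaleTheta

open Literature.AnabelianGeometry.SemiGraphs

namespace MuTwoSetting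

variable {p : ℕ} [Fact p.Prime] {M : MuTwoSetting p}

/-- **«`g` (a lift of `ε_±`, i.e. of multiplication by `−1`) acts by `−1` on `(Δ^tp_X)^ell`»**, algebraic form: for
`x ∈ Δ^tp_X`, the image in `(Π^tp_X)^ell` of `g x g⁻¹` (the restricted inner automorphism `CLevelData.conjFun g`) is
the inverse of the image of `x` (Rmk. 2.1.1 «`ι` acts on `Q` by multiplication by `−1`»; `(Δ^tp_X)^ell = Δ^ab` is the
Tate module of the elliptic curve, p. 12). [cite: MochizukiEtTh2009, Rmk 2.1.1 p.36] -/
def InvActsByNegOnEllAt (M : MuTwoSetting p) (g : M.GtpC) : Prop :=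
  ∀ x ∈ M.DeltaTemp, M.thetaToEll (M.toTheta (CLevelData.conjFun g x)) = (M.thetaToEll (M.toTheta x))⁻¹

/-- **The census predicate C4** («`ε_±` acts by `−1` on `(Δ^tp_X)^ell`», GAP G-L2t10-4 (a)) over a C-level datum
`e` (augmentation `Π^tp_C → G_K`): for every GEOMETRIC element `g ∈ Δ^tp_C ∖ Δ^tp_X` — the lifts of `ι = ε_±` —
(R1e′) holds: `ĝ(y)·y ∈ ⁅Δ_X, Δ_X⁆⁻` for `y ∈ Δ_X`, `ĝ = completionAut (e.conjX g)` (the binder `hinv` of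
abc-iut-L2-t10's `piCData_inv_ell_of_hinv`). [cite: MochizukiEtTh2009, Prop 2.2 (i) p.37] -/
def CLevelData.InvActsByNegOnEll (e : M.CLevelData) : Prop :=
  ∀ g : M.GtpC, e.augC g = 1 → g ∉ M.inclX.range →
    ∀ y ∈ M.DeltaHat, M.completionAut (e.conjX g) y * y ∈ (⁅M.DeltaHat, M.DeltaHat⁆).topologicalClosure

/-- **The algebraic form IS (R1e′)** for the restricted inner automorphism `e.conjX g` («decided on the tempered
group», abc-iut-w5-d072's `completionAut_mul_self_mem_iff`, and the root field `ker_toEll`: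
`Ker(Π^tp_X ↠ (Π^tp_X)^ell) = ι_X⁻¹ ⁅Δ_X, Δ_X⁆⁻`). [cite: MochizukiEtTh2009, Prop 2.2 (i) p.37] -/
theorem invActsByNegOnEllAt_iff_hinv (e : M.CLevelData) (g : M.GtpC) :
    M.InvActsByNegOnEllAt g ↔
      ∀ y ∈ M.DeltaHat, M.completionAut (e.conjX g) y * y ∈ (⁅M.DeltaHat, M.DeltaHat⁆).topologicalClosure := by
  rw [TemperedCurve.completionAut_mul_self_mem_iff]
  refine forall₂_congr fun x hx => ?_
  have hker : (e.conjX g x * x ∈ (M.thetaToEll.comp M.toTheta).ker) ↔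
      M.toHat (e.conjX g x * x) ∈ (⁅M.DeltaHat, M.DeltaHat⁆).topologicalClosure := by
    rw [M.ker_toEll, Subgroup.mem_comap]
    rfl
  rw [← hker, MonoidHom.mem_ker, MonoidHom.comp_apply, map_mul, map_mul, mul_eq_one_iff_eq_inv]
  rfl

/-- An **inversion automorphism of the root kind** (`ThetaSetting.IsInversionAut`, clause `ell_apply`) realised as a
restricted inner automorphism `e.conjX g` gives the algebraic clause at `g`.
[cite: MochizukiEtTh2009, Prop 1.5 (iii) p.23] -/
theorem InvActsByNegOnEllAt.of_isInversionAut (e : M.CLevelData) {g : M.GtpC}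
    (h : M.toThetaSetting.IsInversionAut (e.conjX g)) : M.InvActsByNegOnEllAt g :=
  fun x hx => h.ell_apply x hx

/-- **The census predicate ⟺ the algebraic clause at every geometric `g ∉ Π^tp_X`.**
[cite: MochizukiEtTh2009, Prop 2.2 (i) p.37] -/
theorem CLevelData.invActsByNegOnEll_iff (e : M.CLevelData) :
    e.InvActsByNegOnEll ↔
      ∀ g : M.GtpC, e.augC g = 1 → g ∉ M.inclX.range → M.InvActsByNegOnEllAt g := by
  refine forall_congr' fun g => forall_congr' fun _ => forall_congr' fun _ => ?_
  rw [invActsByNegOnEllAt_iff_hinv e g]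

end MuTwoSetting

end Literature.AnabelianGeometry.EtaleTheta

end
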